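import Mathlib
import Summits.Langlands.Langlands.Theses.PicardMuOrdinary
import Summits.Langlands.Langlands.Theorems.IrregularClassicality.Negative.EmbeddingWLOG
import Literature.NumberTheory.GaloisRepresentations.CubicResidueSymbol
import Literature.NumberTheory.GaloisRepresentations.GaloisRep
import Literature.NumberTheory.GaloisRepresentations.HeckeCharacter
import Literature.NumberTheory.Automorphic.UnitaryGroupAutomorphicRep
import Literature.NumberTheory.Automorphic.MokWeakBaseChange

/-!
# Line `sen-kills-cousin-on-p2` — checked skeleton for the crux
`Summit.Langlands.Langlands.Theses.PicardMuOrdinary.IrregularClassicality` (stmt-Langlands-13758)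

Planner crux-plan (round 1), idea card `Ideas/sen-kills-cousin-on-p2.md` (merged in triage with
`sen-cousin-anisotropic-saddle`), triage `TRIAGE-r1-{1,2,3}.md` (3 × pass), standing disproof
`Disproof.lean` (cycle 2: NO `_false_without_` theorem exists — the crux is the target weakened by a
hypothesis, items 2, 14; normal form "fix the embedding" item 11 / landed
`Theorems/IrregularClassicality/Negative/EmbeddingWLOG.lean`, USED below).  Six registered stubs
`stub_*` (sorried; each a genuine lemma of the line) and the kernel-checked composition
`IrregularClassicality_of : IrregularClassicality` (pure logic; the only `sorry`s are inside the
stubs).  See `Lines/sen-kills-cousin-on-p2.md` for the line card.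

GEN-2 RE-CHECK (planner crux-plan g2, 2026-08-16): statements UNCHANGED (the six registered stub
signatures and `IrregularClassicality_of` are byte-identical to the g1 registration); `lean check`
rc 0 on the current tree, sorries only in `stub_*`, audit = proof-of-item of the route decl by name;
`ledger skeleton check` OK.  Re-read `Disproof.lean` cycle 2 (items 13–20): item 20's CM ANCHOR
`f₆₇ = x⁴ + 167902x² + 9913320x + 4964048425` (admissible, `Gal = A₄`, Jacobian CM by the cyclic sextic
`M = ℚ(ω)·K₀(67)`, `λ`-basic) is an instance of Stub M case (1) (`V_e ≅ Ind_{Γ_M}^{Γ_K} ψ`) and is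
consistent with Stub A (`Ind ψ` is absolutely irreducible: the three `Gal(M/K)`-conjugates of `ψ` have
distinct Hodge–Tate types); items 13/19 (non-recurring normal form) are optional conveniences for the
lead, not used by the composition.  Stub N's hypotheses were checked against BCGP Prop. 272 AS PRINTED
(arXiv:2502.20645 p. 77: Zariski closure `⊇ Sp₄` + ES relation on a density-one set of Frobenii ⇒
`s ≅ ρ^{⊕m}`, via Nekovář (A'), (C'), part (3), minuscule standard representation): for `GL₃` the
elementary pair (i) strong irreducibility + (ii) one element with eigenvalues off the `GO₃` pattern
`(λ, λu, λu⁻¹)` forces closure `⊇ SL₃` (a connected irreducible subgroup of `SL₃` is `SL₃` or `SO₃(q)`,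
and `N_{GL₃}(SO₃(q)) = GO₃(q)`), so N is the printed theorem with `Sp₄ ↦ SL₃`.  §Parity (Stub T) is
re-derived below in its clean `∀ k` form.  Docstrings of T, A, M amended; nothing else.

Notation in comments: `K = ℚ(ω) = CyclotomicField 3 ℚ`, `λ = (1 - ω)` its prime above `3`
(RAMIFIED, `K_λ/ℚ₃` quadratic), `c` = complex conjugation of `K/ℚ`, `C : y³ = f(x)` the Picard
curve, `ρ_C : Γ_K → GL₃(ℚ̄₃)` the `ω`-eigenpart of its `3`-adic Tate module (Hodge–Tate weights
`{0,0,1} | {0,1,1}`, polarized with ODD multiplier: `ρ_C^c ≅ ρ_C^∨ ⊗ ε⁻¹`), `a_𝔭(f) = picardTrace f 𝔭`,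
`U = U_{K/ℚ}(3)` Mok's quasi-split unitary group in three variables (`UnitaryGroup.quasiSplitDatum`;
`U(ℝ) ≅ U(2,1)`, `U(ℚ₃)` the ramified quasi-split unitary group), `Sh` the Picard modular surface,
`FL = P_μ \ GL₃ = ℙ²` its flag variety with the three Bruhat cells `Id` (point), `s` (line), `w₀`
(open), `H^i_w(κ)†` the higher Coleman theories of Boxer–Pilloni / BCGP §4 at weight `κ`.

Shape of the line (BCGP 2025 `p`-adic Eichler–Shimura machine, arXiv:2502.20645 §4, run on `ℙ²` at
the ramified quasi-split prime; Rogawski/Mok endgame):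
* `stub_twistedUnitaryTower` (TRANSFER = the card's `PolarizedLimit`, CORRECTED): the typed `GL₃`
  tower of the hypothesis is replaced by a tower of cuspidal `π_k` on `U` whose standard
  base-change Satake parameters approximate `a_𝔭(f)` AFTER TWISTING by a fixed algebraic Hecke
  character `χ` of `K`.  The twist is forced: a base change from the isometry group `U` is
  conjugate self-dual on the nose (even multiplier), `ρ_C` has odd multiplier `ε⁻¹`, so NO tower
  congruent to `ρ_C` mod `3^k`, `k ≥ 2`, consists of conjugate-self-dual `P_k` (line card §Parity;
  this corrects the restate `IsConjSelfDualAE` proposed in triage F1).  Interface debt of every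
  `U(2,1)` line (Disproof item 17(a)); trivial once the 13757 → 13758 interface is re-cut this way.
* `stub_picardGaloisRep`: the Galois input `ρ_C` (absolutely irreducible, unramified off `S₀ ∋ λ`,
  geometric Frobenius trace `ι⁻¹(e₀(a_𝔭 f))`) — the sibling crux's Stub A with the embedding fixed.
* `stub_eichlerShimuraTypic`: Nekovář's abstract Eichler–Shimura ⇒ typicity theorem (BCGP
  Prop. 272) for `(GL₃, std)`: big image (strong irreducibility + one generic semisimple element,
  which excludes the `Sym²` form) and `charpoly(ρ(Frob_𝔭))(s(Frob_𝔭)) = 0` off `S₁` force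
  `s ≅ ρ^{⊕ m}`.
* `stub_senCousinClassicalityP2` — THE LEVER (hardest): on `V = H²(RHom_𝔟(λ_μ, RΓ(Sh^tor_{Kᵖ},
  ℚ̄₃)^{la}))_𝔪` the unitary tower gives the characteristic-`0` point `𝔭_C` of the big Hecke
  algebra; occurrence + finiteness give a finite-dimensional `Γ_K`-representation `s = V[𝔭_C]`
  with its Eichler–Shimura relation; the TYPICITY PRINCIPLE (Stub N, consumed as a hypothesis)
  makes it `ρ_C^{⊕m}`; then the Sen
  operator on `V[𝔭_C] = D_Sen(ρ_C)^{⊕m}` is semisimple (`ρ_C` de Rham), its nilpotent part = the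
  single Cousin arrow `H⁰_{Id}(1,1,1)† → H¹_{s}(1,1,1)†` between the two colliding cells of `ℙ²`
  (Sen = Cousin, BCGP Thm. 271 transplanted) vanishes on the eigenclass, which is therefore a
  CLASSICAL weight-`(1,1,1)` cusp form on `U`; Rogawski stability + Mok base change return a
  cuspidal L-algebraic `Π` on `GL₃/K` with `χ(ϖ_𝔭) Σ Sat(Π,𝔭) = e₀(a_𝔭 f)` a.e.
* `stub_untwist`: `Π ⊗ (χ ∘ det)` (twist by an ALGEBRAIC, infinite-order Hecke character: API absent
  from the tree) is cuspidal L-algebraic with Satake parameters `χ(ϖ_𝔭)·α` — the conclusion.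
* `stub_cmCorner`: the complement of the big-image case (CM Jacobian, or `Sym²`-type image) —
  automorphy by cubic automorphic induction (Disproof item 17(c); card point 5), resp. vacuous by
  Hodge–Tate weights.
-/

open Literature.NumberTheory.GaloisRepresentations Literature.NumberTheory.Automorphic
open IsDedekindDomain NumberField Polynomial

set_option linter.dupNamespace false

namespace Summit.Langlands.Langlands.Cruxes.IrregularClassicality.SenKillsCousinOnP2

/-! ## The six stubs -/

/-- **Stub T — the twisted unitary tower (transfer; the line's `PolarizedLimit`, corrected).**
For generic `f` and a fixed embedding `e₀`, the typed `3`-adic tower of regular algebraic cuspidal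
`P_k` on `GL₃(𝔸_K)` with `N𝔭·ΣSat(P_k,𝔭) ≡ e₀(a_𝔭 f) mod 3^k ℤ̄_𝔐` off `S` may be replaced by:
the non-trivial automorphism `c` of `K/ℚ`, an ALGEBRAIC Hecke character `χ` of `K` unramified off
`S'`, and for every `k` a cuspidal automorphic representation `π_k` of Mok's quasi-split unitary
group `U_{K/ℚ}(3)` possessing a regular algebraic cuspidal weak base change `P'_k` on `GL₃(𝔸_K)`
(so `π_k` is cohomological and seen by the cohomology of the Picard surface) and standard
base-change Satake parameters `β` off `S'` with `χ(ϖ_𝔭)·Σβ(π_k,𝔭) ≡ e₀(a_𝔭 f) mod 3^k ℤ̄_𝔐'`.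
WHY THE TWIST (line card §Parity): `BC(π)` is conjugate self-dual on the nose, i.e. of weight `0`
with even polarization `r^c ≅ r^∨`; `ρ_C^c ≅ ρ_C^∨ ⊗ ε⁻¹` (Weil pairing `V_e × V_ē → ℚ₃(-1)`,
`V_ē ≅ V_e^c`).  In the crux's normalisation (`r_P(Frob_𝔭^{geom})` has eigenvalues `N𝔭·α_j`),
`IsConjSelfDualAE c` (`Sat(P, c𝔭) = Sat(P, 𝔭)⁻¹`) reads `r_P^c ≅ r_P^∨ ⊗ ε⁻²` (EVEN); the trace
congruences `tr r_{P_k} ≡ tr ρ_C mod 3^k ℤ̄_𝔐` (Chebotarev + continuity: on all of `Γ_K`) then give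
`tr ρ_C^c ≡ tr(ρ_C^∨ ⊗ ε⁻²) mod 3^k` for EVERY `k`, hence equality (g2: the disprover's
`eq_zero_of_forall_congr`, §3 of `Disproof.lean`), hence `ρ_C^c ≅ ρ_C^∨ ⊗ ε⁻²` by Brauer–Nesbitt —
impossible by purity (Weil: every eigenvalue of `ρ_C^c(Frob_𝔭)` has absolute value `N𝔭^{1/2}`,
every eigenvalue of `(ρ_C^∨ ⊗ ε⁻²)(Frob_𝔭)` has `N𝔭^{3/2}`, and isomorphic representations share
eigenvalues; e.g. `|det|` is `N𝔭^{3/2}` versus `N𝔭^{9/2}`).  (At finite depth the same computation reads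
`a_{c𝔭}(1 - N𝔭) ≡ 0 mod 3^k ℤ̄_𝔐` for all `𝔭 ∉ S`; already `k = 2` fails for generic `f` at a prime with
`v₃(1 - N𝔭) = 1` and `v_λ(a_𝔭) ≤ 1`, but the `∀ k` form needs no Chebotarev bookkeeping.)  So adding
`IsConjSelfDualAE` to the `P_k` would make 13757's conclusion unsatisfiable and 13758 vacuous.
The unitary avatar of the Picard motive is `ρ_C ⊗ ψ`, `ψ`
algebraic of infinity type `(1,0)` (`ψψ^c = ‖·‖^{∓1}`; such `ψ` exist, `K` has class number `1`);
intended `χ = ψ^{∓1}` up to `‖·‖`-powers, absorbed by `∃ χ`.  STATUS: interface debt shared by every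
`U(2,1)` line (triage F1, Disproof 17(a)): as typed, descending the non-polarized `P_k` is blocked
(`TwistedEndoscopySelfDual`) and producing polarized regular approximants of `ρ_C ⊗ ψ` is a
`13757`-type statement (eigenvariety/Hida accumulation on `U`); it becomes a bookkeeping lemma the
moment the tenure planner re-cuts the 13757 → 13758 interface as "`P_k ⊗ χ⁻¹` is a standard weak
base change from `U_{K/ℚ}(3)`" (NOT as `IsConjSelfDualAE`, which is unsatisfiable for `k ≥ 2`).
Size: M after the restate; XL (= 13757) as typed.  Not to be staffed before the restate decision. -/
theorem stub_twistedUnitaryTower :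
    ∀ (f : ℤ[X]) (hcpt : isCompact_glFiniteIntegralLevel 3 (CyclotomicField 3 ℚ)),
      f.natDegree = 4 → (f.map (Int.castRingHom ℚ)).Separable →
      12 ∣ Nat.card (f.map (Int.castRingHom ℚ)).Gal →
    ∀ (e₀ : CyclotomicField 3 ℚ →+* ℂ),
      (∃ (𝔐 : Ideal (integralClosure ℤ ℂ))
          (S : Finset (HeightOneSpectrum (𝓞 (CyclotomicField 3 ℚ)))), 𝔐.IsMaximal ∧
          (3 : integralClosure ℤ ℂ) ∈ 𝔐 ∧ ∀ k : ℕ,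
          ∃ P : CuspidalAutomorphicRepData 3 (CyclotomicField 3 ℚ) hcpt, P.1.IsRegularAlgebraic ∧
            ∀ 𝔭 ∉ S, ∃ (α : Multiset ℂ) (t u : integralClosure ℤ ℂ), P.1.HasSatakeParamAt 𝔭 α ∧
              (t : ℂ) = (𝔭.residueCard : ℂ) * α.sum - e₀ (picardTrace f 𝔭) ∧ u ∉ 𝔐 ∧
              u * t ∈ Ideal.span {(3 : integralClosure ℤ ℂ) ^ k}) →
    ∃ (c : CyclotomicField 3 ℚ ≃ₐ[ℚ] CyclotomicField 3 ℚ), c ≠ 1 ∧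
    ∃ (χ : HeckeCharacter (CyclotomicField 3 ℚ)) (𝔐 : Ideal (integralClosure ℤ ℂ))
      (S : Finset (HeightOneSpectrum (𝓞 (CyclotomicField 3 ℚ)))),
      χ.IsAlgebraic ∧ 𝔐.IsMaximal ∧ (3 : integralClosure ℤ ℂ) ∈ 𝔐 ∧
      (∀ 𝔭 ∉ S, χ.IsUnramifiedAt 𝔭) ∧
      ∀ k : ℕ, ∃ (π : UnitaryGroup.CuspidalAutomorphicRepData ℚ (CyclotomicField 3 ℚ) c 3 hcpt)
        (P : CuspidalAutomorphicRepData 3 (CyclotomicField 3 ℚ) hcpt),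
        P.1.IsRegularAlgebraic ∧
        UnitaryGroup.IsWeakBaseChange ℚ (CyclotomicField 3 ℚ) c 3 hcpt P.1 π.1 ∧
        ∀ 𝔭 ∉ S, ∃ (β : Multiset ℂ) (t u : integralClosure ℤ ℂ),
          UnitaryGroup.HasBaseChangeSatakeAt ℚ (CyclotomicField 3 ℚ) c 3 hcpt π.1 𝔭 β ∧
          (t : ℂ) = χ.valueAtUniformizer 𝔭 * β.sum - e₀ (picardTrace f 𝔭) ∧ u ∉ 𝔐 ∧
          u * t ∈ Ideal.span {(3 : integralClosure ℤ ℂ) ^ k} := by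
  sorry

/-- **Stub A — the Galois input `ρ_C` at a prescribed embedding.**  For a separable quartic
`f ∈ ℤ[X]` with `12 ∣ #Gal(f)` and EVERY embedding `e₀ : K → ℂ` there are a field isomorphism
`ι : ℚ̄₃ ≃ ℂ`, a finite set `S₀` of finite places of `K = ℚ(ω)` containing every place above `3`,
and a continuous `ρ : Γ_K → GL₃(ℚ̄₃)` (intended: the `ω`-eigenpart `V_{e₀}` of the `3`-adic Tate
module of the Jacobian of `C : y³ = f(x)`, read through `ι`) which is absolutely irreducible (its
reduction is the reflection representation of `Gal(f) ∈ {A₄, S₄}` on `𝔽₃⁴/diag`, Poonen–Schaefer /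
Upton), unramified at every `𝔭 ∉ S₀`, with GEOMETRIC Frobenius trace `ι⁻¹(e₀(a_𝔭(f)))` at `𝔭 ∉ S₀`
(twisted Lefschetz on the `ω`-eigenpart, Disproof item 16: `tr(F_q^* | H¹[ū^* = ι(ω)]) = ι(a_𝔭 f)`
for EVERY embedding `ι`).  Identical with Stub A (`stub_picardGaloisInput`) of the sibling line
`Cruxes/MuOrdinaryFamilyRT/Lines/weight-blind-lambda-adic-rt.lean` except that the embedding is
prescribed (WLOG: replace `ι` by `ι` followed by complex conjugation).  Absolute irreducibility
holds for EVERY admissible `f`, CM members included (g2, Disproof item 20: for `f₆₇`,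
`V_e ≅ Ind_{Γ_M}^{Γ_K} ψ` with `M/K` cyclic cubic, irreducible because the conjugates `ψ, ψ^σ, ψ^{σ²}`
have distinct Hodge–Tate types; residually it is the reflection representation of `A₄`, irreducible on
`𝔽₃⁴/diag`).  Size L (Tate module of the Picard Jacobian absent from Mathlib; tree:
`SuperellipticTorsionRep`, `CubicResidueSymbol`, `PadicAlgCl.nonempty_ringEquiv_complex`). -/
theorem stub_picardGaloisRep :
    ∀ (f : ℤ[X]), f.natDegree = 4 → (f.map (Int.castRingHom ℚ)).Separable →
      12 ∣ Nat.card (f.map (Int.castRingHom ℚ)).Gal →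
    ∀ (e₀ : CyclotomicField 3 ℚ →+* ℂ),
    ∃ (ι : PadicAlgCl 3 ≃+* ℂ)
      (S₀ : Finset (HeightOneSpectrum (𝓞 (CyclotomicField 3 ℚ))))
      (ρ : FramedGaloisRep (CyclotomicField 3 ℚ) (PadicAlgCl 3) 3),
      (∀ v : HeightOneSpectrum (𝓞 (CyclotomicField 3 ℚ)),
        ((3 : ℕ) : 𝓞 (CyclotomicField 3 ℚ)) ∈ v.asIdeal → v ∈ S₀) ∧
      FramedRep.IsAbsolutelyIrreducible ρ ∧
      ∀ 𝔭 ∉ S₀, ρ.IsUnramifiedAt 𝔭 ∧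
        ∀ 𝔓 ∈ 𝔭.primesAbove, ∀ τ : Field.absoluteGaloisGroup (CyclotomicField 3 ℚ),
          IsArithFrobAt (𝓞 (CyclotomicField 3 ℚ)) τ 𝔓 →
            FramedRep.trace ρ τ⁻¹ = ι.symm (e₀ (picardTrace f 𝔭)) := by
  sorry

/-- **Stub N — Eichler–Shimura relation ⇒ typicity (Nekovář; BCGP 2025 Prop. 272 for `(GL₃, std)`).**
Let `ρ : Γ_K → GL₃(ℚ̄₃)` be continuous with BIG IMAGE in the elementary form (i) `ρ` is absolutely
irreducible on `Γ_L` for every finite extension `L/K` (strong irreducibility: excludes the induced =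
CM case) and (ii) some `ρ(g)` has three pairwise distinct eigenvalues `x, y, z` satisfying no
relation `xz = y²`, `xy = z²`, `yz = x²` (excludes an image in `GO₃`, i.e. the `Sym²` form) — so the
Zariski closure of `ρ(Γ_K)` contains `SL₃`, its `ℚ̄₃`-Lie algebra contains `𝔰𝔩₃` (an `Ad`-stable
subspace which is not central, by (i)), and the standard representation is minuscule.  Let
`s : Γ_K → GL_n(ℚ̄₃)` be continuous and suppose the EICHLER–SHIMURA RELATION off a finite `S₁`:
`s`, `ρ` unramified at `𝔭` and `charpoly(ρ(Frob_𝔓))(s(Frob_𝔓)) = 0` for every arithmetic Frobenius.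
Then `s ≅ ρ^{⊕ m}`: `n = 3m` and `s = P · diag(ρ, …, ρ) · P⁻¹`.  Proof in print: Nekovář,
*Eichler–Shimura relations and semisimplicity of étale cohomology of quaternionic Shimura varieties*,
Ann. Sci. ÉNS 51 (2018), abstract part (3) [MR3942040], as applied in BCGP arXiv:2502.20645
Prop. 272 (p. 77): hypothesis (C') from Chebotarev (Frobenii off `S₁` are dense), (A') from the Lie
algebra computation above; semisimplicity of `s` because a generic element of `ρ(Γ_K)` is regular
semisimple, so `s(Frob)` is killed by a separable cubic for a dense set of Frobenii.  Size L
(Chebotarev density `chebotarev_artinRep`/`frobenius_dense`-type facts exist in the tree; compact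
subgroups of `GL_n(ℚ̄₃)` lie in `GL_n(E)`, `E/ℚ₃` finite; `p`-adic Lie theory à la Nekovář §§3–4 is
NOT in the tree). -/
theorem stub_eichlerShimuraTypic :
    ∀ (S₁ : Finset (HeightOneSpectrum (𝓞 (CyclotomicField 3 ℚ))))
      (ρ : FramedGaloisRep (CyclotomicField 3 ℚ) (PadicAlgCl 3) 3)
      (n : ℕ) (s : FramedGaloisRep (CyclotomicField 3 ℚ) (PadicAlgCl 3) n),
      (∀ (L : Type) [Field L] [NumberField L] [Algebra (CyclotomicField 3 ℚ) L],
        FramedRep.IsAbsolutelyIrreducible (ρ.restrictField L)) →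
      (∃ (g : Field.absoluteGaloisGroup (CyclotomicField 3 ℚ)) (x y z : PadicAlgCl 3),
        FramedRep.charpoly ρ g = (X - C x) * (X - C y) * (X - C z) ∧
        x ≠ y ∧ y ≠ z ∧ x ≠ z ∧ x * z ≠ y ^ 2 ∧ x * y ≠ z ^ 2 ∧ y * z ≠ x ^ 2) →
      (∀ 𝔭 ∉ S₁, s.IsUnramifiedAt 𝔭 ∧ ρ.IsUnramifiedAt 𝔭 ∧
        ∀ 𝔓 ∈ 𝔭.primesAbove, ∀ τ : Field.absoluteGaloisGroup (CyclotomicField 3 ℚ),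
          IsArithFrobAt (𝓞 (CyclotomicField 3 ℚ)) τ 𝔓 →
            Polynomial.aeval ((s τ : GL (Fin n) (PadicAlgCl 3)) : Matrix (Fin n) (Fin n) (PadicAlgCl 3))
              (FramedRep.charpoly ρ τ) = 0) →
    ∃ (m : ℕ) (e : Fin n ≃ Fin 3 × Fin m) (P : GL (Fin n) (PadicAlgCl 3)),
      ∀ g : Field.absoluteGaloisGroup (CyclotomicField 3 ℚ),
        ((s g : GL (Fin n) (PadicAlgCl 3)) : Matrix (Fin n) (Fin n) (PadicAlgCl 3)) =
          (P : Matrix (Fin n) (Fin n) (PadicAlgCl 3)) *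
            Matrix.reindex e.symm e.symm
              (Matrix.blockDiagonal fun _ : Fin m =>
                ((ρ g : GL (Fin 3) (PadicAlgCl 3)) : Matrix (Fin 3) (Fin 3) (PadicAlgCl 3))) *
            ((P⁻¹ : GL (Fin n) (PadicAlgCl 3)) : Matrix (Fin n) (Fin n) (PadicAlgCl 3)) := by
  sorry

/-- **Stub B — THE LEVER (hardest): Sen kills the single Cousin arrow on `ℙ²`; classicality in
weight `(1,1,1)` on the Picard surface at the ramified quasi-split prime, GIVEN typicity.**
Data: generic `f`, the twisted unitary tower of Stub T (`c`, `χ`, `𝔐`, `S`, `π_k` with regular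
algebraic weak base changes and `χ(ϖ_𝔭)Σβ(π_k,𝔭) ≡ e₀(a_𝔭 f) mod 3^k ℤ̄_𝔐`), and the Galois input of
Stub A (`ι`, `S₀ ⊇ {v ∣ 3}`, `ρ` absolutely irreducible with geometric Frobenius traces
`ι⁻¹ e₀(a_𝔭 f)` off `S₀`; by Chebotarev + Brauer–Nesbitt `ρ ≅ ρ_C`, so `ρ` is de Rham at `λ` with
Hodge–Tate type `μ = ((1,1,0),(1,0,0))` and residually the reflection representation).
Last hypothesis (TYPICITY PRINCIPLE for `ρ`, the conclusion of Stub N with its big-image hypotheses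
discharged): every continuous `s : Γ_K → GL_n(ℚ̄₃)` satisfying the Eichler–Shimura relation w.r.t.
`ρ` off a finite set (`s`, `ρ` unramified and `charpoly(ρ(Frob_𝔓))` annihilates `s(Frob_𝔓)`) is
`ρ`-typic, `s ≅ ρ^{⊕m}`; the proof applies it to `s = V[𝔭_C]` of (b.ii).  Conclusion (CLASSICALITY in
`GL₃` currency): a cuspidal L-algebraic `Π` on `GL₃(𝔸_K)` with `χ(ϖ_𝔭) · Σ Sat(Π, 𝔭) = e₀(a_𝔭 f)` for
almost all `𝔭`.
INTENDED PROOF (BCGP arXiv:2502.20645 §4 — written for Hodge-type data with `G_{ℚ_p}` QUASI-SPLIT,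
p. 48 l. 13 — transplanted from `LG(2,4)` to `FL = ℙ²`, cells `Id, s, w₀`, Sen scalars `(1,1,0)` after
shift (triage r1-3: one colliding pair), at `p = 3` ramified in `K`, `F = ℚ`):
(b.i) HECKE POINT: bounded tame level (Swan conductors of `r(P'_k) ≡ ρ_C ⊗ ψ` at `𝔭 ∈ S ∖ λ` are that
  of `ρ̄_C`, so `a(𝔭) ≤ 3 + Swan`), `𝔪 = 𝔪_{ρ̄_C⊗ψ̄}` non-Eisenstein, and the `π_k` make `λ_C` (the
  `χ`-twisted Picard eigensystem) a characteristic-`0` point `𝔭_C` of the big Hecke algebra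
  `𝕋(Kᵖ)_𝔪` acting on `V = H²(RHom_𝔟(λ_μ, RΓ(Sh^tor_{Kᵖ}, ℚ̄₃)^{la}))_𝔪` (locally analytic completed
  cohomology of the perfectoid Picard surface; Rodríguez Camargo arXiv:2209.01057, BCGP Thm. 184).
(b.ii) OCCURRENCE + FINITENESS: `Gr⁰V = H⁰_{Id}(Sh^tor_{Kᵖ}, ω^{(1,1,1),sm})†` carries a non-zero
  `𝔭_C`-eigenvector and `V[𝔭_C]` is FINITE-dimensional and `≠ 0`; `s` := the `Γ_K`-action on
  `V[𝔭_C]` (continuous: finite-dimensional subspace of a Hausdorff `Γ_K`-module), to which the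
  typicity hypothesis is applied once (b.iii) is known.  Triage correction
  built in (r1-1 (b), r1-2 F2, saddle card (iii)): the `s`-cell of `ℙ²` has NO `K_λ`-rational isotropic
  point, `π_HT(μ-ordinary locus) ⊂ C_{Id} ∪ C_{w₀}`, so `Gr¹V = H¹_s†` has no μ-ordinary incarnation
  and its `[𝔭_C]`-finiteness must come from finite-slope theory at the BASIC saddle `[e₂]`
  (`diag(3,1,1/3) ∈ T(ℚ₃)` regular on `ℙ²`) or an admissibility + infinitesimal-character device
  (Dospinescu–Paškūnas–Schraen) — NOT from a `T(ℚ₃)`-ordinary projector (card point 6 dropped for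
  `Gr¹`).  In the μ-ordinary regime of the route `Gr⁰[𝔭_C]` is reached by the single ordinary
  refinement (card point 6 for `Gr⁰` only); slope-free otherwise (Pan-type).
(b.iii) EICHLER–SHIMURA in completed cohomology of `Sh` (congruence relation for `GU(2,1)`,
  Koskivirta 2014 / Bültel–Wedhorn; BCGP Thm. "ESRFC" shape): `s` satisfies the Eichler–Shimura
  relation w.r.t. `ρ` off `S₁ = S ∪ S₀ ∪ bad`, so `V[𝔭_C] ≅ ρ_C^{⊕m}` (BCGP Lemma 276 transplanted).
(b.iv) SEN = COUSIN on `ℙ²` (the ONE NEW THEOREM; BCGP Thm. 271 via Pilloni's `VB`-functors and the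
  `𝒟`-module `Loc(M(𝔤)_λ)` on the `Q`-orbit `C_{Id} ∪ C_s`; `𝔲_{(2,1)}` abelian, `λ_μ` algebraic hence
  non-Liouville): on the generalized-eigenvalue part `0 → H¹_s† → V_{ℂ₃}[(Θ-θ)²] → H⁰_{Id}† → 0` the
  nilpotent part of the arithmetic Sen operator `Θ` equals the Cousin map up to a unit, whose kernel
  is the classical `H⁰(Sh^tor_{Kᵖ}, ω^{(1,1,1)})` (Cousin complex in degrees `[0,1]`, compactly
  supported variant `HC_{cusp}` if the "proper or Siegel" boundary clause fails for the Picard cusps).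
(b.v) GIVEN TYPICITY `V[𝔭_C] ≅ ρ_C^{⊕m}`: `Θ|V[𝔭_C] = Θ_{Sen}(ρ_C) ⊗ 1` is SEMISIMPLE because `ρ_C`
  (Tate module of an abelian variety) is de Rham — so the `𝔭_C`-eigenvector of `Gr⁰` lies in
  `ker(Cousin)`: a classical cuspidal eigenform of weight `(1,1,1)` = a cuspidal automorphic `π` of
  `U` with `π_∞` the holomorphic non-degenerate limit of discrete series (packet `{π^hol, π^nh}` of
  `λ = (1|1,0)`, ideator's `decide` check) and eigensystem `λ_C`; exactness of `[𝔭_C]` on the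
  two-step sequence (BCGP hyp. (3) of Thm. 277) from Rogawski multiplicity one.
(b.vi) ENDGAME on `U(3)` (replaces Arthur for `GSp₄`, BCGP Rem. 279): `π` is STABLE — an endoscopic
  `π` (Rogawski: from `U(1,1) × U(1)`, i.e. Hecke characters and base changes of holomorphic
  `GL₂/ℚ`-forms, all with Galois representations) would make `ρ_C ⊗ ψ` reducible — so its standard
  weak base change (`Mok2014_weakBaseChange`, Rogawski 1990) is CUSPIDAL, L-algebraic of weight `0`
  (exponents `(λ_i, -λ_i)`, `λ = (1,1,0)` integral since `N = 3` is odd; archimedean compatibility of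
  base change), with `χ(ϖ_𝔭)·ΣSat = e₀(a_𝔭 f)` a.e. by the congruences at all depths + strong
  multiplicity one / `hasSatakeParamAt_unique`.
Barriers: `NonRegularWeightBarrier` evaded (coherent `H⁰/H¹` avatar, never Betti weight);
`ModPLanglandsGL2BeyondQp` bites only (b.ii)'s finiteness device (flagged, not hidden);
`TwistedEndoscopySelfDual` is quarantined in Stub T.  Size XL (new theorem (b.iv) + the slope-free
finiteness (b.ii) at a quasi-split non-split prime; everything else printed for `GSp₄`). -/
theorem stub_senCousinClassicalityP2 :
    ∀ (f : ℤ[X]) (hcpt : isCompact_glFiniteIntegralLevel 3 (CyclotomicField 3 ℚ)),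
      f.natDegree = 4 → (f.map (Int.castRingHom ℚ)).Separable →
      12 ∣ Nat.card (f.map (Int.castRingHom ℚ)).Gal →
    ∀ (c : CyclotomicField 3 ℚ ≃ₐ[ℚ] CyclotomicField 3 ℚ), c ≠ 1 →
    ∀ (e₀ : CyclotomicField 3 ℚ →+* ℂ) (χ : HeckeCharacter (CyclotomicField 3 ℚ))
      (𝔐 : Ideal (integralClosure ℤ ℂ)) (S : Finset (HeightOneSpectrum (𝓞 (CyclotomicField 3 ℚ)))),
      χ.IsAlgebraic → 𝔐.IsMaximal → (3 : integralClosure ℤ ℂ) ∈ 𝔐 →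
      (∀ 𝔭 ∉ S, χ.IsUnramifiedAt 𝔭) →
      (∀ k : ℕ, ∃ (π : UnitaryGroup.CuspidalAutomorphicRepData ℚ (CyclotomicField 3 ℚ) c 3 hcpt)
        (P : CuspidalAutomorphicRepData 3 (CyclotomicField 3 ℚ) hcpt),
        P.1.IsRegularAlgebraic ∧
        UnitaryGroup.IsWeakBaseChange ℚ (CyclotomicField 3 ℚ) c 3 hcpt P.1 π.1 ∧
        ∀ 𝔭 ∉ S, ∃ (β : Multiset ℂ) (t u : integralClosure ℤ ℂ),
          UnitaryGroup.HasBaseChangeSatakeAt ℚ (CyclotomicField 3 ℚ) c 3 hcpt π.1 𝔭 β ∧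
          (t : ℂ) = χ.valueAtUniformizer 𝔭 * β.sum - e₀ (picardTrace f 𝔭) ∧ u ∉ 𝔐 ∧
          u * t ∈ Ideal.span {(3 : integralClosure ℤ ℂ) ^ k}) →
    ∀ (ι : PadicAlgCl 3 ≃+* ℂ) (S₀ : Finset (HeightOneSpectrum (𝓞 (CyclotomicField 3 ℚ))))
      (ρ : FramedGaloisRep (CyclotomicField 3 ℚ) (PadicAlgCl 3) 3),
      (∀ v : HeightOneSpectrum (𝓞 (CyclotomicField 3 ℚ)),
        ((3 : ℕ) : 𝓞 (CyclotomicField 3 ℚ)) ∈ v.asIdeal → v ∈ S₀) →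
      FramedRep.IsAbsolutelyIrreducible ρ →
      (∀ 𝔭 ∉ S₀, ρ.IsUnramifiedAt 𝔭 ∧
        ∀ 𝔓 ∈ 𝔭.primesAbove, ∀ τ : Field.absoluteGaloisGroup (CyclotomicField 3 ℚ),
          IsArithFrobAt (𝓞 (CyclotomicField 3 ℚ)) τ 𝔓 →
            FramedRep.trace ρ τ⁻¹ = ι.symm (e₀ (picardTrace f 𝔭))) →
      (∀ (n : ℕ) (s : FramedGaloisRep (CyclotomicField 3 ℚ) (PadicAlgCl 3) n)
          (S₁ : Finset (HeightOneSpectrum (𝓞 (CyclotomicField 3 ℚ)))),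
        (∀ 𝔭 ∉ S₁, s.IsUnramifiedAt 𝔭 ∧ ρ.IsUnramifiedAt 𝔭 ∧
          ∀ 𝔓 ∈ 𝔭.primesAbove, ∀ τ : Field.absoluteGaloisGroup (CyclotomicField 3 ℚ),
            IsArithFrobAt (𝓞 (CyclotomicField 3 ℚ)) τ 𝔓 →
              Polynomial.aeval ((s τ : GL (Fin n) (PadicAlgCl 3)) : Matrix (Fin n) (Fin n) (PadicAlgCl 3))
                (FramedRep.charpoly ρ τ) = 0) →
        ∃ (m : ℕ) (e : Fin n ≃ Fin 3 × Fin m) (P : GL (Fin n) (PadicAlgCl 3)),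
          ∀ g : Field.absoluteGaloisGroup (CyclotomicField 3 ℚ),
            ((s g : GL (Fin n) (PadicAlgCl 3)) : Matrix (Fin n) (Fin n) (PadicAlgCl 3)) =
              (P : Matrix (Fin n) (Fin n) (PadicAlgCl 3)) *
                Matrix.reindex e.symm e.symm
                  (Matrix.blockDiagonal fun _ : Fin m =>
                    ((ρ g : GL (Fin 3) (PadicAlgCl 3)) : Matrix (Fin 3) (Fin 3) (PadicAlgCl 3))) *
                ((P⁻¹ : GL (Fin n) (PadicAlgCl 3)) : Matrix (Fin n) (Fin n) (PadicAlgCl 3))) →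
    ∃ Q : CuspidalAutomorphicRepData 3 (CyclotomicField 3 ℚ) hcpt, Q.1.IsLAlgebraic ∧
      ∀ᶠ 𝔭 : HeightOneSpectrum (𝓞 (CyclotomicField 3 ℚ)) in Filter.cofinite,
        ∃ α : Multiset ℂ, Q.1.HasSatakeParamAt 𝔭 α ∧
          χ.valueAtUniformizer 𝔭 * α.sum = e₀ (picardTrace f 𝔭) := by
  sorry

/-- **Stub C — untwisting by an algebraic Hecke character (known; API missing).**  If `Π` is a
cuspidal L-algebraic automorphic representation of `GL₃(𝔸_K)` and `χ` an ALGEBRAIC Hecke character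
of `K`, unramified off `S`, with `χ(ϖ_𝔭) · Σ Sat(Π, 𝔭) = e₀(a_𝔭 f)` for almost all `𝔭`, then the
conclusion of the crux holds at `e₀`: `π := Π ⊗ (χ ∘ det)` is cuspidal automorphic
(Borel–Jacquet 4.4–4.6; the tree's `CuspidalAutomorphicRepData.twist` covers only FINITE-ORDER `χ`
— the infinite-order algebraic twist needs the archimedean component `z^{-p} z̄^{-q}` threaded
through `IsAutomorphicForm`: moderate growth and `Z(𝔤)`-finiteness), L-algebraic (integral exponents
shift by `(-p, -q)`), and has Satake parameter `χ(ϖ_𝔭)·α` at every `𝔭` where `Π` and `χ` are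
unramified (`HasSatakeParamAt.twist_of_isUnramifiedAt` shape), so `Σ = χ(ϖ_𝔭) Σα = e₀(a_𝔭 f)` a.e.
Size M. -/
theorem stub_untwist :
    ∀ (f : ℤ[X]) (hcpt : isCompact_glFiniteIntegralLevel 3 (CyclotomicField 3 ℚ))
      (e₀ : CyclotomicField 3 ℚ →+* ℂ) (χ : HeckeCharacter (CyclotomicField 3 ℚ))
      (S : Finset (HeightOneSpectrum (𝓞 (CyclotomicField 3 ℚ)))),
      χ.IsAlgebraic → (∀ 𝔭 ∉ S, χ.IsUnramifiedAt 𝔭) →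
    ∀ (Q : CuspidalAutomorphicRepData 3 (CyclotomicField 3 ℚ) hcpt), Q.1.IsLAlgebraic →
      (∀ᶠ 𝔭 : HeightOneSpectrum (𝓞 (CyclotomicField 3 ℚ)) in Filter.cofinite,
        ∃ α : Multiset ℂ, Q.1.HasSatakeParamAt 𝔭 α ∧
          χ.valueAtUniformizer 𝔭 * α.sum = e₀ (picardTrace f 𝔭)) →
    ∃ π : CuspidalAutomorphicRepData 3 (CyclotomicField 3 ℚ) hcpt, π.1.IsLAlgebraic ∧
      ∀ᶠ 𝔭 : HeightOneSpectrum (𝓞 (CyclotomicField 3 ℚ)) in Filter.cofinite,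
        ∃ α : Multiset ℂ, π.1.HasSatakeParamAt 𝔭 α ∧ α.sum = e₀ (picardTrace f 𝔭) := by
  sorry

/-- **Stub M — the complement of the big-image case (CM corner; card point 5, Disproof 17(c)).**
If the Picard representation `ρ` of Stub A (absolutely irreducible, geometric Frobenius traces
`ι⁻¹ e₀(a_𝔭 f)`, hence `ρ ≅ ρ_C`) FAILS the big-image hypothesis of Stub N, the conclusion of the
crux holds at `e₀` outright.  Two cases. (1) `ρ|Γ_L` reducible for some finite `L/K`: an absolutely
irreducible representation of prime dimension `3` that is reducible on an open normal subgroup is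
isotypic there (excluded: `ρ_C` is Hodge–Tate with weights `{0,0,1}`, not a twist of an Artin
representation) or INDUCED, `ρ ≅ Ind_{Γ_M}^{Γ_K} θ` with `M/K` cubic and `θ` a geometric, hence
algebraic (Weil/Serre), Hecke character of `M` — the CM-Jacobian corner; then
`Π := AI_{M/K}(θ) ⊗ (unitary normalisation)` is cuspidal (irreducibility) L-algebraic automorphic on
`GL₃(𝔸_K)` with `ΣSat = e₀(a_𝔭 f)` (cyclic `M/K`: Arthur–Clozel; non-normal cubic: JPSS 1981, the tree's
`automorphicInduction_unitaryCharacter_cubic`). (2) `ρ` strongly irreducible but EVERY `ρ(g)` has a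
repeated eigenvalue or a relation `xz = y²`: the Zariski closure lies in `GO₃`, so on an open subgroup
`ρ ≅ Sym² σ ⊗ η`, whose Hodge–Tate weights `{2a+c, a+b+c, 2b+c}` can repeat only if all three
coincide — impossible for `{0,0,1}`; vacuous.  Case (1) is NOT vacuous inside the admissible class
(g2, Disproof item 20): `f₆₇ = x⁴ + 167902x² + 9913320x + 4964048425` has `Gal = A₄` and CM Jacobian
(`M = ℚ(ω)·K₀(67)` cyclic sextic, Lario–Somoza arXiv:1611.02582 §4.3; `a_𝔭(f₆₇) = 0` exactly at the
split primes inert in `K₀`), `λ`-BASIC — the lead's end-to-end test instance for this stub (cyclic case: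
Arthur–Clozel induction of `ψ`).  Size L (Clifford theory + Hodge–Tate weights of the Picard Tate
module + cubic automorphic induction with Satake bookkeeping). -/
theorem stub_cmCorner :
    ∀ (f : ℤ[X]) (hcpt : isCompact_glFiniteIntegralLevel 3 (CyclotomicField 3 ℚ)),
      f.natDegree = 4 → (f.map (Int.castRingHom ℚ)).Separable →
      12 ∣ Nat.card (f.map (Int.castRingHom ℚ)).Gal →
    ∀ (e₀ : CyclotomicField 3 ℚ →+* ℂ) (ι : PadicAlgCl 3 ≃+* ℂ)
      (S₀ : Finset (HeightOneSpectrum (𝓞 (CyclotomicField 3 ℚ))))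
      (ρ : FramedGaloisRep (CyclotomicField 3 ℚ) (PadicAlgCl 3) 3),
      FramedRep.IsAbsolutelyIrreducible ρ →
      (∀ 𝔭 ∉ S₀, ρ.IsUnramifiedAt 𝔭 ∧
        ∀ 𝔓 ∈ 𝔭.primesAbove, ∀ τ : Field.absoluteGaloisGroup (CyclotomicField 3 ℚ),
          IsArithFrobAt (𝓞 (CyclotomicField 3 ℚ)) τ 𝔓 →
            FramedRep.trace ρ τ⁻¹ = ι.symm (e₀ (picardTrace f 𝔭))) →
      ¬ ((∀ (L : Type) [Field L] [NumberField L] [Algebra (CyclotomicField 3 ℚ) L],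
            FramedRep.IsAbsolutelyIrreducible (ρ.restrictField L)) ∧
          ∃ (g : Field.absoluteGaloisGroup (CyclotomicField 3 ℚ)) (x y z : PadicAlgCl 3),
            FramedRep.charpoly ρ g = (X - C x) * (X - C y) * (X - C z) ∧
            x ≠ y ∧ y ≠ z ∧ x ≠ z ∧ x * z ≠ y ^ 2 ∧ x * y ≠ z ^ 2 ∧ y * z ≠ x ^ 2) →
    ∃ π : CuspidalAutomorphicRepData 3 (CyclotomicField 3 ℚ) hcpt, π.1.IsLAlgebraic ∧
      ∀ᶠ 𝔭 : HeightOneSpectrum (𝓞 (CyclotomicField 3 ℚ)) in Filter.cofinite,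
        ∃ α : Multiset ℂ, π.1.HasSatakeParamAt 𝔭 α ∧ α.sum = e₀ (picardTrace f 𝔭) := by
  sorry

/-! ## The composition: the six stubs imply the crux, by name -/

/-- `ℚ(ω)` has a complex embedding (`#(K →+* ℂ) = [K : ℚ] > 0`). [folklore] -/
theorem nonempty_embedding : Nonempty (CyclotomicField 3 ℚ →+* ℂ) := by
  have h : 0 < Fintype.card (CyclotomicField 3 ℚ →+* ℂ) := by
    rw [NumberField.Embeddings.card]
    exact Module.finrank_pos
  exact Fintype.card_pos_iff.mp h

/-- **The line concludes the crux.**  Fix an embedding `e₀` (landed Negative lemma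
`irregularClassicality_iff_fixed`: both `∃ e` are innocuous).  For generic `f` with a `3`-adic
`GL₃`-tower at `e₀`: Stub A gives `ρ_C` at `e₀`; if `ρ_C` has big image, Stub T replaces the tower
by the `χ`-twisted unitary tower, Stub N (specialised to `ρ_C`) supplies the typicity principle,
Stub B — Sen = Cousin on `ℙ²` — produces the cuspidal L-algebraic `Π` with
`χ(ϖ_𝔭)ΣSat = e₀(a_𝔭 f)`, which Stub C untwists into the conclusion; otherwise Stub M (CM corner)
concludes directly.  Kernel-checked; the only `sorry`s are inside the six stubs.  The crux
hypothesis `H` (the tower) is consumed by Stub T (hence B): there is no `_false_without_H` theorem to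
honour (Disproof items 2, 14: dropping `H` gives the target `X`), and Stub M's `H`-free regime is the
CM corner where `X` holds unconditionally on paper (Disproof 17(c)). -/
theorem IrregularClassicality_of :
    Summit.Langlands.Langlands.Theses.PicardMuOrdinary.IrregularClassicality := by
  classical
  obtain ⟨e₀⟩ := nonempty_embedding
  rw [Summit.Langlands.Langlands.Theorems.IrregularClassicality.Negative.irregularClassicality_iff_fixed
    e₀]
  intro f hcpt hdeg hsep hgal hlim
  -- Stub A: the Picard representation at the embedding e₀
  obtain ⟨ι, S₀, ρ, hS₀, hirr, htr⟩ := stub_picardGaloisRep f hdeg hsep hgal e₀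
  by_cases hbig :
      ((∀ (L : Type) [Field L] [NumberField L] [Algebra (CyclotomicField 3 ℚ) L],
          FramedRep.IsAbsolutelyIrreducible (ρ.restrictField L)) ∧
        ∃ (g : Field.absoluteGaloisGroup (CyclotomicField 3 ℚ)) (x y z : PadicAlgCl 3),
          FramedRep.charpoly ρ g = (X - C x) * (X - C y) * (X - C z) ∧
          x ≠ y ∧ y ≠ z ∧ x ≠ z ∧ x * z ≠ y ^ 2 ∧ x * y ≠ z ^ 2 ∧ y * z ≠ x ^ 2)
  swap
  · -- Stub M: CM corner / small image
    exact stub_cmCorner f hcpt hdeg hsep hgal e₀ ι S₀ ρ hirr htr hbig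
  obtain ⟨hstrong, hgen⟩ := hbig
  -- Stub T: the χ-twisted unitary tower
  obtain ⟨c, hc, χ, 𝔐, S, hχalg, h𝔐, h3, hχS, htower⟩ :=
    stub_twistedUnitaryTower f hcpt hdeg hsep hgal e₀ hlim
  -- Stub N: Eichler–Shimura ⇒ typicity, for every Γ_K-representation `s` satisfying the
  -- Eichler–Shimura relation with respect to ρ (Stub B applies it to `s = V[𝔭_C]`)
  have hNek : ∀ (n : ℕ) (s : FramedGaloisRep (CyclotomicField 3 ℚ) (PadicAlgCl 3) n)
      (S₁ : Finset (HeightOneSpectrum (𝓞 (CyclotomicField 3 ℚ)))),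
      (∀ 𝔭 ∉ S₁, s.IsUnramifiedAt 𝔭 ∧ ρ.IsUnramifiedAt 𝔭 ∧
        ∀ 𝔓 ∈ 𝔭.primesAbove, ∀ τ : Field.absoluteGaloisGroup (CyclotomicField 3 ℚ),
          IsArithFrobAt (𝓞 (CyclotomicField 3 ℚ)) τ 𝔓 →
            Polynomial.aeval ((s τ : GL (Fin n) (PadicAlgCl 3)) : Matrix (Fin n) (Fin n) (PadicAlgCl 3))
              (FramedRep.charpoly ρ τ) = 0) →
      ∃ (m : ℕ) (e : Fin n ≃ Fin 3 × Fin m) (P : GL (Fin n) (PadicAlgCl 3)),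
        ∀ g : Field.absoluteGaloisGroup (CyclotomicField 3 ℚ),
          ((s g : GL (Fin n) (PadicAlgCl 3)) : Matrix (Fin n) (Fin n) (PadicAlgCl 3)) =
            (P : Matrix (Fin n) (Fin n) (PadicAlgCl 3)) *
              Matrix.reindex e.symm e.symm
                (Matrix.blockDiagonal fun _ : Fin m =>
                  ((ρ g : GL (Fin 3) (PadicAlgCl 3)) : Matrix (Fin 3) (Fin 3) (PadicAlgCl 3))) *
              ((P⁻¹ : GL (Fin n) (PadicAlgCl 3)) : Matrix (Fin n) (Fin n) (PadicAlgCl 3)) :=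
    fun n s S₁ hES => stub_eichlerShimuraTypic S₁ ρ n s hstrong hgen hES
  -- Stub B: Sen = Cousin on ℙ² — classicality of the 𝔭_C-eigenclass, given typicity
  obtain ⟨Q, hL, hsat⟩ :=
    stub_senCousinClassicalityP2 f hcpt hdeg hsep hgal c hc e₀ χ 𝔐 S hχalg h𝔐 h3 hχS htower
      ι S₀ ρ hS₀ hirr htr hNek
  -- Stub C: untwist
  exact stub_untwist f hcpt e₀ χ S hχalg hχS Q hL hsat

end Summit.Langlands.Langlands.Cruxes.IrregularClassicality.SenKillsCousinOnP2
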